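import Summits.BirchSwinnertonDyer.BirchSwinnertonDyer.Theorems.ByReductionTypeAtTwoOrdKatoHalfAtTwoIsoZetaColemanMuIotaChain
import Literature.NumberTheory.EllipticCurves.IwasawaAlgebraInvolution
import HarnessLib

/-!
# Route ByReductionTypeAtTwo, crux `OrdKatoHalfAtTwoIso` (stmt-BirchSwinnertonDyer-19573), line `steinberg-fibre-at-two`:
# the two DISPLAYED TEXTS of the planner's package P8′ (pen RC-388 s66 / RC-389) — F1μι⁻ (the ι-keyed zeta/Coleman reading on
# `Δ < 0`) and the DIRECT `0 < Δ` child `OrdKatoHalfAtTwoIsoPosDisc` (currency (β)) — definitions only, nothing asserted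

Seat `cruxlead-stmt-BirchSwinnertonDyer-19573-g5` (LEAD PROVER, MODE LINE; HOME `run/shared/lean/pub/bsd-2adic/`). DEFINITIONS of two
OPEN statements displayed BY NAME (so that the K4 route children can be their texts verbatim / by name), their `Iff.rfl` unfoldings, and
two monotonicity lemmas. HONEST FRAMING (cell bsd-2adic): BSD is not proved by any of this; the crux `OrdKatoHalfAtTwoIso` is NOT proved;
the two definitions are `@[conjecture]` obligation nodes, NOT Literature facts, nothing is asserted about them.

WHY (lead memo `Cruxes/OrdKatoHalfAtTwoIso/RELINE-posDisc.md`, finding `…/LEAD-FINDING-F27a-posDisc.md`). The P7 sign-free F1 child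
`ZetaColemanMuInputsAtTwo` (23959) is (a) mis-keyed (its column map `τ` is `ι`-SEMILINEAR, w3 RC-383 R-b; kernel chain p690167/p691108/
p691807) and (b) WITHOUT a Kato witness on two-real-component curves (`0 < Δ`): on a rectangular period lattice every Kato class is booked at
twice the tree-normalised `2`-adic `L`-function (F-27a, c_∞ = 2), so in the expected world every genuine class lies in `2·𝐇¹_Γ(T₂W)` there
(Negative lemma p691215 + R∞). Hence P8′: the F1 child shrinks to its honest `Δ < 0` reading in the honest keying — `ZetaColemanMuIotaNegDiscAtTwo`
below (= hypothesis `hZθ` of w3's `ordKatoHalfAtTwoIso_of_zetaColemanMuTheta_cite`, p691807, at `θ = ι := IwasawaAlgebra.involEquiv 2`,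
with the binder `W.Δ < 0 →` inserted after `ρ̄₂` onto; VERBATIM the registered stub `stub_ZCmu_iota_negDisc` of skeleton v12) — and the
cell [ρ̄₂ onto ∧ 0 < Δ] becomes its OWN child in currency (β) = DIRECT: `OrdKatoHalfAtTwoIsoPosDisc` below = the crux's own conclusion
restricted to that cell («no mechanism yet»; research ideas: half-Kato Euler / Kolyvagin systems at `p = 2` with the real places,
`Gal(ℚ(i)/ℚ)`-descent with exact `×2` control). The split-glue door consuming the two texts is the sequel `…OrdKatoHalfAtTwoIsoPosDiscSplit.lean`.

References: K. Kato, Astérisque 295 (2004) Thm. 12.6, Thm. 16.2, Thm. 16.6, 17.5, Prop. 17.11, §17.13 [Kato2004Asterisque]; B. Mazur,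
J. Tate, J. Teitelbaum, Invent. Math. 84 (1986) §I.8, §I.17 [MazurTateTeitelbaum1986Invent]; R. Greenberg, LNM 1716 (1999) Conj. 1.11,
Thm. 4.1 [GreenbergLNM1716]; tree p684479 (`…SignFreeDefs`), p691807 (`…IotaChain`), p691215 (`…/Negative/ZetaColemanMuTwoDivisible`).
-/

set_option autoImplicit false
set_option linter.dupNamespace false

noncomputable section

open scoped Classical MatrixGroups ModularForm NumberField
open CongruenceSubgroup WeierstrassCurve Field IsDedekindDomain NumberField
open Literature.NumberTheory.GaloisRepresentations
open Literature.NumberTheory.GaloisCohomology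
open Literature.NumberTheory.EllipticCurves Literature.NumberTheory.EllipticCurves.ModularForms
open Literature.NumberTheory.EllipticCurves.Kato2004
  Literature.NumberTheory.EllipticCurves.Kato2004.EulerSystemValues
open Literature.NumberTheory.EllipticCurves.Rank1Residual
open Literature.NumberTheory.EllipticCurves.Greenberg1999
open Summit.BirchSwinnertonDyer.BirchSwinnertonDyer.Theorems.Rank1ResidualX1Defs
  Summit.BirchSwinnertonDyer.BirchSwinnertonDyer.Rank1Residual
  Summit.BirchSwinnertonDyer.BirchSwinnertonDyer.Rank1Residual.CoreAssembly
open Summit.BirchSwinnertonDyer.Rank1Residual Summit.BirchSwinnertonDyer.Rank1Residual.X5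
open Summit.BirchSwinnertonDyer.BirchSwinnertonDyer.Theorems.OrdKatoOptimalAtTwo
  Summit.BirchSwinnertonDyer.BirchSwinnertonDyer.Theorems.OrdKatoIntAtTwo
open Summit.BirchSwinnertonDyer.BirchSwinnertonDyer.Theses.ByReductionTypeAtTwo

namespace Summit.BirchSwinnertonDyer.BirchSwinnertonDyer.Theorems.SteinbergFibreAtTwo

/-! ## §1 F1μι⁻ — Kato's zeta classes in Coleman coordinates at `2`, ι-KEYED, on `Δ < 0` -/

/-- [MEMO tier, OPEN] **F1μι⁻ — the ι-keyed zeta/Coleman `μ`-inputs at `p = 2` on `Δ < 0` (lead g5, P8′ text for child 23959).**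
For every globally minimal `W`, good ordinary at `2`, `ρ̄_{W,2}` onto, `Δ_W < 0`, its newform `f`, the cyclotomic `(κ, γ)`, every
Selmer dual datum `D` and fine datum `Y`: a pinned `𝐇¹`, `Z` inside the span of GENUINE `2`-adic Euler-system classes, an ideal
`P ⊆ Λ`, a `Λ`-linear `ℓ : 𝐇¹ → P`, an `ι`-SEMILINEAR column map `τ : P →ₛₗ[ι] X` (`ι = IwasawaAlgebra.involEquiv 2`,
`T ↦ (1+T)⁻¹ − 1`; the honest keying of the local Tate pairing, w3 p690167/p691108) killing `ℓ(Z)` with image `ker(X ↠ X₀)`, and the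
zeta image clause at `(2)` (`s ∉ (2)`, `s·G₁ ∈ ℓ(Z)` for `ι G₁ = L₂(f, α)`). VERBATIM the hypothesis `hZθ` of
`ordKatoHalfAtTwoIso_of_zetaColemanMuTheta_cite` (p691807) at `θ = ι` with `W.Δ < 0 →` inserted after `ρ̄₂` onto; = the registered stub
`stub_ZCmu_iota_negDisc` of skeleton v12. On `Δ < 0` Kato's own system is a witness at memo tier (the class of `γ = γ₁^∨ ∈ T₂E`, not
«good for `T`», is booked by 16.2/16.6 exactly at the tree-normalised values — lead finding F-27a). A READING of Kato §§12–17 at `2`,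
NOT in print as stated; NOT a Literature fact; nothing asserted.
[cite: Kato2004Asterisque, Thm. 12.6 (p. 222), Thm. 16.2 (p. 269), Thm. 16.6 (p. 271), Prop. 17.11 (p. 277), §17.13 (pp. 279–280) (shape only; nothing asserted)] -/
@[conjecture] def ZetaColemanMuIotaNegDiscAtTwo : Prop :=
  ∀ (W : WeierstrassCurve ℚ) [W.IsElliptic] [W.IsGloballyMinimal]
      [ContinuousSMul ℤ_[2] (W.tateModule 2)] [Module.Free ℤ_[2] (W.tateModule 2)]
      [Module.Finite ℤ_[2] (W.tateModule 2)] {N : ℕ} [NeZero N] (f : CuspForm (Gamma0 N) 2)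
      (κ : ZpExtension ℚ 2) (γ : absoluteGaloisGroup ℚ) (hκ : κ.IsCyclotomic),
      IsOrdinaryAt W 2 → W.HasSurjectiveModNGaloisRep 2 → W.Δ < 0 → 
      κ.IsTopGenerator γ → IsCyclotomicVariable 2 γ → IsNewformOf W f →
      ∀ (D : W.SelmerDualData κ γ) (Y : W.FineSelmerDualData κ γ),
        ∃ (I : IwasawaH1Data W 2 κ γ)
          (Z : Submodule (IwasawaAlgebra 2) I.H) (P : Submodule (IwasawaAlgebra 2) (IwasawaAlgebra 2))
          (ℓ : I.H →ₗ[IwasawaAlgebra 2] P)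
          (τ : P →ₛₗ[((IwasawaAlgebra.involEquiv 2).toRingEquiv : IwasawaAlgebra 2 →+* IwasawaAlgebra 2)] D.X)
          (π : D.X →ₗ[IwasawaAlgebra 2] Y.X),
          Z ≤ Submodule.span (IwasawaAlgebra 2) {s : I.H | IsEulerSystemClassTwo W hκ I s} ∧
          (∀ z ∈ Z, τ (ℓ z) = 0) ∧ Function.Surjective π ∧ Function.Exact τ π ∧
          ∀ G₁ : IwasawaAlgebra 2,
            iwasawaToPowerSeries 2 G₁ = padicLFunction f (unitRoot W 2 : ℚ_[2]) →
              ∃ s : IwasawaAlgebra 2, s ∉ IwasawaAlgebra.augIdealP 2 ∧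
                s * G₁ ∈ Submodule.map (P.subtype ∘ₗ ℓ) Z

/-- `ZetaColemanMuIotaNegDiscAtTwo` unfolds to its displayed body. [folklore] -/
theorem zetaColemanMuIotaNegDiscAtTwo_iff : ZetaColemanMuIotaNegDiscAtTwo ↔
    ∀ (W : WeierstrassCurve ℚ) [W.IsElliptic] [W.IsGloballyMinimal]
      [ContinuousSMul ℤ_[2] (W.tateModule 2)] [Module.Free ℤ_[2] (W.tateModule 2)]
      [Module.Finite ℤ_[2] (W.tateModule 2)] {N : ℕ} [NeZero N] (f : CuspForm (Gamma0 N) 2)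
      (κ : ZpExtension ℚ 2) (γ : absoluteGaloisGroup ℚ) (hκ : κ.IsCyclotomic),
      IsOrdinaryAt W 2 → W.HasSurjectiveModNGaloisRep 2 → W.Δ < 0 → 
      κ.IsTopGenerator γ → IsCyclotomicVariable 2 γ → IsNewformOf W f →
      ∀ (D : W.SelmerDualData κ γ) (Y : W.FineSelmerDualData κ γ),
        ∃ (I : IwasawaH1Data W 2 κ γ)
          (Z : Submodule (IwasawaAlgebra 2) I.H) (P : Submodule (IwasawaAlgebra 2) (IwasawaAlgebra 2))
          (ℓ : I.H →ₗ[IwasawaAlgebra 2] P)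
          (τ : P →ₛₗ[((IwasawaAlgebra.involEquiv 2).toRingEquiv : IwasawaAlgebra 2 →+* IwasawaAlgebra 2)] D.X)
          (π : D.X →ₗ[IwasawaAlgebra 2] Y.X),
          Z ≤ Submodule.span (IwasawaAlgebra 2) {s : I.H | IsEulerSystemClassTwo W hκ I s} ∧
          (∀ z ∈ Z, τ (ℓ z) = 0) ∧ Function.Surjective π ∧ Function.Exact τ π ∧
          ∀ G₁ : IwasawaAlgebra 2,
            iwasawaToPowerSeries 2 G₁ = padicLFunction f (unitRoot W 2 : ℚ_[2]) →
              ∃ s : IwasawaAlgebra 2, s ∉ IwasawaAlgebra.augIdealP 2 ∧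
                s * G₁ ∈ Submodule.map (P.subtype ∘ₗ ℓ) Z :=
  Iff.rfl

/-- **Monotonicity: the sign-free ι-keyed supply F1μ⁺ι (hypothesis `hZθ` of p691807 at `θ = ι`) implies F1μι⁻** (restrict to
`Δ < 0`; the binder is simply dropped). [folklore] -/
theorem zetaColemanMuIotaNegDiscAtTwo_of_iota_signFree
    (hZι : ∀ (W : WeierstrassCurve ℚ) [W.IsElliptic] [W.IsGloballyMinimal]
      [ContinuousSMul ℤ_[2] (W.tateModule 2)] [Module.Free ℤ_[2] (W.tateModule 2)]
      [Module.Finite ℤ_[2] (W.tateModule 2)] {N : ℕ} [NeZero N] (f : CuspForm (Gamma0 N) 2)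
      (κ : ZpExtension ℚ 2) (γ : absoluteGaloisGroup ℚ) (hκ : κ.IsCyclotomic),
      IsOrdinaryAt W 2 → W.HasSurjectiveModNGaloisRep 2 → 
      κ.IsTopGenerator γ → IsCyclotomicVariable 2 γ → IsNewformOf W f →
      ∀ (D : W.SelmerDualData κ γ) (Y : W.FineSelmerDualData κ γ),
        ∃ (I : IwasawaH1Data W 2 κ γ)
          (Z : Submodule (IwasawaAlgebra 2) I.H) (P : Submodule (IwasawaAlgebra 2) (IwasawaAlgebra 2))
          (ℓ : I.H →ₗ[IwasawaAlgebra 2] P)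
          (τ : P →ₛₗ[((IwasawaAlgebra.involEquiv 2).toRingEquiv : IwasawaAlgebra 2 →+* IwasawaAlgebra 2)] D.X)
          (π : D.X →ₗ[IwasawaAlgebra 2] Y.X),
          Z ≤ Submodule.span (IwasawaAlgebra 2) {s : I.H | IsEulerSystemClassTwo W hκ I s} ∧
          (∀ z ∈ Z, τ (ℓ z) = 0) ∧ Function.Surjective π ∧ Function.Exact τ π ∧
          ∀ G₁ : IwasawaAlgebra 2,
            iwasawaToPowerSeries 2 G₁ = padicLFunction f (unitRoot W 2 : ℚ_[2]) →
              ∃ s : IwasawaAlgebra 2, s ∉ IwasawaAlgebra.augIdealP 2 ∧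
                s * G₁ ∈ Submodule.map (P.subtype ∘ₗ ℓ) Z) :
    ZetaColemanMuIotaNegDiscAtTwo :=
  fun W _ _ _ _ _ _ _ f κ γ hκ hord h2 _ hγ hγ' hf D Y => hZι W f κ γ hκ hord h2 hγ hγ' hf D Y

/-! ## §2 The DIRECT `0 < Δ` child (currency (β)) -/

/-- [RESEARCH, OPEN — «no mechanism yet»] **`OrdKatoHalfAtTwoIsoPosDisc` — the crux `OrdKatoHalfAtTwoIso` on the cell
[`ρ̄₂` onto ∧ `0 < Δ`] (lead g5, P8′ currency (β), pen RC-389 (2)).** For every globally minimal, non-CM, analytic-rank-`0`,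
good-ordinary-at-`2` curve `W/ℚ` with `ρ̄_{W,2}` onto `GL₂(𝔽₂)` and `0 < Δ_W` (two real components): some isogenous globally minimal
`W′` satisfies Kato's lower divisibility `X5.O1.MainConjectureLowerDivisibilityAtTwoOrd W′` (integral, for the tree-normalised `2`-adic
`L`-function). VERBATIM the body of the route decl `OrdKatoHalfAtTwoIso` with the two binders `W.HasSurjectiveModNGaloisRep 2 → 0 < W.Δ →`
inserted after `GoodOrd W 2 →`. WHY ITS OWN CHILD: the line `steinberg-fibre-at-two` closes the complement of this cell modulo memo/print
readings (F1μι⁻, B7′, the print bundle; the core Theorem A at `2` is PROVED on `Δ < 0`, p669276), but on this cell its mechanism is void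
as typed — CoreA⁺ (`CoreTheoremAPosDiscTwo`, PROVED p691138) needs a genuine Euler-system class `∉ 2𝐇¹`, and on a rectangular period lattice
every Kato class is booked at `2·L₂^{tree}` (F-27a), hence lies in `2𝐇¹` in the expected world (`μ(X) = μ(X₀)`); the other world
(`μ(X) > μ(X₀)`) makes THIS statement false at `W`. Candidate mechanisms (crux Ideas, none in print): an integral Euler system at half of
Kato's; Kolyvagin systems at `p = 2` over the totally real `ℚ_n` with archimedean local conditions (Mazur–Rubin 2004 assume `p > 2`);
`Gal(ℚ(i)/ℚ)`-descent from Kato's imaginary tower with exact control of the `×2` in (14.9.3)/(17.13.1). NOT a Literature fact; nothing asserted.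
[cite: Kato2004Asterisque, Thm. 17.4 (p. 273), (14.9.3) (p. 240), §17.13 (pp. 279–280) (shape only; nothing asserted)] [cite: GreenbergLNM1716, Conj. 1.11 (p. 64) (shape only)] -/
@[conjecture] def OrdKatoHalfAtTwoIsoPosDisc : Prop :=
  ∀ (W : WeierstrassCurve ℚ) [W.IsElliptic] [W.IsGloballyMinimal], ¬ W.HasCM → W.analyticRank = 0 →
    Literature.NumberTheory.EllipticCurves.Rank1Residual.GoodOrd W 2 → W.HasSurjectiveModNGaloisRep 2 → 0 < W.Δ →
    ∃ (W' : WeierstrassCurve ℚ) (_ : W'.IsElliptic) (_ : W'.IsGloballyMinimal),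
      WeierstrassCurve.IsIsogenous W W' ∧ Summit.BirchSwinnertonDyer.Rank1Residual.X5.O1.MainConjectureLowerDivisibilityAtTwoOrd W'

/-- `OrdKatoHalfAtTwoIsoPosDisc` unfolds to its displayed body. [folklore] -/
theorem ordKatoHalfAtTwoIsoPosDisc_iff : OrdKatoHalfAtTwoIsoPosDisc ↔
    ∀ (W : WeierstrassCurve ℚ) [W.IsElliptic] [W.IsGloballyMinimal], ¬ W.HasCM → W.analyticRank = 0 →
    Literature.NumberTheory.EllipticCurves.Rank1Residual.GoodOrd W 2 → W.HasSurjectiveModNGaloisRep 2 → 0 < W.Δ →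
    ∃ (W' : WeierstrassCurve ℚ) (_ : W'.IsElliptic) (_ : W'.IsGloballyMinimal),
      WeierstrassCurve.IsIsogenous W W' ∧ Summit.BirchSwinnertonDyer.Rank1Residual.X5.O1.MainConjectureLowerDivisibilityAtTwoOrd W' :=
  Iff.rfl

/-- **Monotonicity: the crux implies its `0 < Δ` cell** (drop the two extra binders). [folklore] -/
theorem ordKatoHalfAtTwoIsoPosDisc_of_ordKatoHalfAtTwoIso (h : OrdKatoHalfAtTwoIso) : OrdKatoHalfAtTwoIsoPosDisc :=
  fun W _ _ hcm hr hgo _ _ => h W hcm hr hgo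

end Summit.BirchSwinnertonDyer.BirchSwinnertonDyer.Theorems.SteinbergFibreAtTwo

end
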